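import Summits.QuantumAdvantage.QuantumAdvantage.Theorems.RingFrameBridge
import Literature.Computability.QuantumComplexity.ShallowCircuitsRing
import Literature.Computability.QuantumComplexity.ShallowCircuitsEncodeProofs
import Summits.QuantumAdvantage.AdviceFreeQNC0.RingKernel
import HarnessLib

/-!
# Many-ring grid bridge, part 1/3: families of disjoint grid cycles and their HLF instances

Module 1 of the split of `MultiRingBridge` (lens-5 «BridgeDial» node, decomp-qadv cell gen 6, tree twin sha256 d782ca8a…; split into three ≤ 400-line modules for landing by the census seat decomp-qadv-census-1 g5 — content VERBATIM, only module boundaries, headers and five helper docstrings added).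

`GridCycles N J n` — `J` pairwise vertex-disjoint cycles of length `n` embedded in the `N × N` grid; `ringsInstance Γ X` — the
2D-HLF instance whose quadratic part is the union of the cycles' adjacency matrices and whose linear part is the pattern `X j`
on cycle `j` (BGK 2018 §4.2 Eq. (31) for a cycle FAMILY with independent linear parts); `ringsInstance_isValid`;
`kerCount_toFun` / `kerCount_eq_zero`; `mem_Lq_iff` (`z ∈ L_q` iff every restriction `z ∘ Γ j` lies in the ring kernel
`K(X j)`); `rel_of_mem_hlfSolutions`; `encodeHLF_ringsInstance_subst` — the single-cycle file `Literature/…/ShallowCircuitsRing.lean` generalised line by line. Parts 2/3: `MultiRingRowSquares` (packing), `MultiRingBridge` (the bridge and item stmt-QuantumAdvantage-26125 closed by name in five routes).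
-/
noncomputable section

open Finset Polynomial
open Literature.Computability.Cryptography Literature.Computability.Complexity
open Literature.Computability.QuantumComplexity Literature.Computability.MetaComplexity
open Literature.Computability.QuantumComplexity.RingHLF

-- the sub-problem namespace `Summit.QuantumAdvantage.QuantumAdvantage` repeats the summit name by design (D-0017)
set_option linter.dupNamespace false

namespace Summit.QuantumAdvantage.QuantumAdvantage.Theorems

open Summit.QuantumAdvantage.AdviceFreeQNC0

/-! ## 1. Families of disjoint cycles embedded in the grid and their HLF instances -/

/-- `J` pairwise vertex-disjoint cycles of length `n` embedded in the `N × N` grid: a map of (cycle, position) to grid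
vertices, injective as a map of pairs, sending cyclically consecutive positions of one cycle to grid neighbours.
(BGK 2018 §4.1 uses one cycle `Γ`; hardness amplification over rings needs many.) -/
structure GridCycles (N J n : ℕ) where
  /-- The embedding of the positions of every cycle. -/
  toFun : Fin J → Fin n → Fin N × Fin N
  /-- The embedding is injective on (cycle, position) pairs. -/
  injective : ∀ {j j' : Fin J} {i i' : Fin n}, toFun j i = toFun j' i' → j = j' ∧ i = i'
  /-- Consecutive positions of a cycle are grid neighbours. -/
  adj : ∀ j i, (gridGraph N).Adj (toFun j i) (toFun j (nxt i))

namespace GridCycles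

variable {N J n : ℕ} (Γ : GridCycles N J n)

/-- The `j`-th cycle of the family as a single grid cycle. -/
def cycle (j : Fin J) : GridCycle N n where
  toFun := Γ.toFun j
  injective := fun _ _ h => (Γ.injective h).2
  adj := Γ.adj j

/-- **The many-ring instance** of 2D HLF with joint pattern `X`: `A` is the adjacency matrix of the union of the cycles,
`b = X j` on cycle `j` and `0` off the cycles. -/
def ringsInstance (X : Fin J → Fin n → Bool) : HLFInstance N where
  A a a' := decide (∃ j i, (Γ.toFun j i = a ∧ Γ.toFun j (nxt i) = a') ∨ (Γ.toFun j i = a' ∧ Γ.toFun j (nxt i) = a))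
  b a := decide (∃ j i, Γ.toFun j i = a ∧ X j i = true)

/-- The indicator vector on the grid of a set of positions of cycle `j`. -/
def ind (j : Fin J) (v : Fin n → Bool) : Fin N × Fin N → Bool :=
  fun a => decide (∃ i, Γ.toFun j i = a ∧ v i = true)

variable {Γ}

/-- The matrix at two embedded positions: adjacency on the same abstract ring. -/
theorem ringsInstance_A_apply (X : Fin J → Fin n → Bool) (j j' : Fin J) (i i' : Fin n) :
    (Γ.ringsInstance X).A (Γ.toFun j i) (Γ.toFun j' i') = true ↔ (j = j' ∧ (i' = nxt i ∨ i = nxt i')) := by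
  simp only [ringsInstance, decide_eq_true_eq]
  constructor
  · rintro ⟨j₀, k, ⟨h1, h2⟩ | ⟨h1, h2⟩⟩
    · obtain ⟨rfl, rfl⟩ := Γ.injective h1
      obtain ⟨h3, h4⟩ := Γ.injective h2
      exact ⟨h3, Or.inl h4.symm⟩
    · obtain ⟨rfl, rfl⟩ := Γ.injective h1
      obtain ⟨h3, h4⟩ := Γ.injective h2
      exact ⟨h3.symm, Or.inr h4.symm⟩
  · rintro ⟨rfl, h | h⟩
    · exact ⟨j, i, Or.inl ⟨rfl, by rw [h]⟩⟩
    · exact ⟨j, i', Or.inr ⟨rfl, by rw [h]⟩⟩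

/-- Entries of the matrix are supported on embedded positions of one and the same cycle. -/
theorem ringsInstance_A_eq_true {X : Fin J → Fin n → Bool} {a a' : Fin N × Fin N}
    (h : (Γ.ringsInstance X).A a a' = true) : ∃ j, (∃ i, Γ.toFun j i = a) ∧ ∃ i', Γ.toFun j i' = a' := by
  simp only [ringsInstance, decide_eq_true_eq] at h
  obtain ⟨j, i, ⟨h1, h2⟩ | ⟨h1, h2⟩⟩ := h
  · exact ⟨j, ⟨i, h1⟩, ⟨nxt i, h2⟩⟩
  · exact ⟨j, ⟨nxt i, h2⟩, ⟨i, h1⟩⟩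

/-- The linear part at an embedded position is the pattern bit of that cycle. -/
theorem ringsInstance_b_apply (X : Fin J → Fin n → Bool) (j : Fin J) (i : Fin n) :
    (Γ.ringsInstance X).b (Γ.toFun j i) = true ↔ X j i = true := by
  simp only [ringsInstance, decide_eq_true_eq]
  constructor
  · rintro ⟨j', k, hk, hx⟩
    obtain ⟨rfl, rfl⟩ := Γ.injective hk
    exact hx
  · intro h; exact ⟨j, i, rfl, h⟩

/-- The linear part is supported on the cycles. -/
theorem ringsInstance_b_eq_true {X : Fin J → Fin n → Bool} {a : Fin N × Fin N}
    (h : (Γ.ringsInstance X).b a = true) : ∃ j i, Γ.toFun j i = a := by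
  simp only [ringsInstance, decide_eq_true_eq] at h
  obtain ⟨j, i, hi, -⟩ := h
  exact ⟨j, i, hi⟩

/-- **Many-ring instances are valid 2D-HLF instances**: `A` is symmetric and supported on grid edges. -/
theorem ringsInstance_isValid (X : Fin J → Fin n → Bool) : (Γ.ringsInstance X).IsValid := by
  constructor
  · intro a a'
    simp only [ringsInstance]
    rw [decide_eq_decide]
    constructor <;> rintro ⟨j, i, h | h⟩
    · exact ⟨j, i, Or.inr h⟩
    · exact ⟨j, i, Or.inl h⟩
    · exact ⟨j, i, Or.inr h⟩
    · exact ⟨j, i, Or.inl h⟩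
  · intro a a' h
    simp only [ringsInstance, decide_eq_true_eq] at h
    obtain ⟨j, i, ⟨rfl, rfl⟩ | ⟨rfl, rfl⟩⟩ := h
    · exact Γ.adj j i
    · exact (Γ.adj j i).symm

/-- The indicator at an embedded position of the same cycle. -/
theorem ind_apply (j : Fin J) (v : Fin n → Bool) (i : Fin n) : Γ.ind j v (Γ.toFun j i) = v i := by
  unfold ind
  rw [Bool.eq_iff_iff, decide_eq_true_eq]
  constructor
  · rintro ⟨k, hk, hv⟩
    obtain ⟨-, rfl⟩ := Γ.injective hk
    exact hv
  · intro h; exact ⟨i, rfl, h⟩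

/-- The indicator of cycle `j` vanishes on the other cycles. -/
theorem ind_apply_ne {j j' : Fin J} (h : j' ≠ j) (v : Fin n → Bool) (i : Fin n) : Γ.ind j v (Γ.toFun j' i) = false := by
  unfold ind
  rw [decide_eq_false_iff_not]
  rintro ⟨k, hk, -⟩
  exact h (Γ.injective hk).1.symm

/-- The indicator is supported on its cycle. -/
theorem ind_eq_true {j : Fin J} {v : Fin n → Bool} {a : Fin N × Fin N} (h : Γ.ind j v a = true) :
    ∃ i, Γ.toFun j i = a := by
  unfold ind at h
  rw [decide_eq_true_eq] at h
  obtain ⟨i, hi, -⟩ := h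
  exact ⟨i, hi⟩

/-- Transport of sums: a grid function vanishing off cycle `j` is summed over the positions of cycle `j`. -/
theorem sum_eq_sum_cycle {M : Type*} [AddCommMonoid M] (Γ : GridCycles N J n) (j : Fin J)
    (f : Fin N × Fin N → M) (hf : ∀ a, (∀ i, Γ.toFun j i ≠ a) → f a = 0) :
    ∑ a, f a = ∑ i, f (Γ.toFun j i) :=
  (Γ.cycle j).sum_eq_sum_toFun f hf

/-- Transport of sums: a grid function vanishing off the cycles is summed over all (cycle, position) pairs. -/
theorem sum_eq_sum_toFun {M : Type*} [AddCommMonoid M] (Γ : GridCycles N J n)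
    (f : Fin N × Fin N → M) (hf : ∀ a, (∀ j i, Γ.toFun j i ≠ a) → f a = 0) :
    ∑ a, f a = ∑ j, ∑ i, f (Γ.toFun j i) := by
  classical
  have hinj : Function.Injective (fun q : Fin J × Fin n => Γ.toFun q.1 q.2) := by
    rintro ⟨j, i⟩ ⟨j', i'⟩ h
    obtain ⟨rfl, rfl⟩ := Γ.injective h
    rfl
  calc ∑ a, f a = ∑ a ∈ univ.image (fun q : Fin J × Fin n => Γ.toFun q.1 q.2), f a := by
        symm
        apply Finset.sum_subset (Finset.subset_univ _)
        intro a _ ha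
        apply hf
        intro j i hi
        exact ha (hi ▸ mem_image_of_mem _ (mem_univ (j, i)))
    _ = ∑ q : Fin J × Fin n, f (Γ.toFun q.1 q.2) := Finset.sum_image fun q _ q' _ h => hinj h
    _ = ∑ j, ∑ i, f (Γ.toFun j i) := Fintype.sum_prod_type _

/-- **The kernel count on a cycle of the family** (`n ≥ 3`): the row of `A + diag b` at a vertex of cycle `j` reads only
the two neighbours on cycle `j` and the pattern bit `X j i`. -/
theorem kerCount_toFun (hn : 3 ≤ n) (X : Fin J → Fin n → Bool) (z : Fin N × Fin N → Bool) (j : Fin J) (i : Fin n) :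
    (Γ.ringsInstance X).kerCount z (Γ.toFun j i) =
      (if z (Γ.toFun j (prv i)) = true then 1 else 0) + (if z (Γ.toFun j (nxt i)) = true then 1 else 0) +
        (if X j i = true ∧ z (Γ.toFun j i) = true then 1 else 0) := by
  unfold HLFInstance.kerCount
  congr 1
  · rw [card_filter, Γ.sum_eq_sum_toFun]
    · -- on the positions: only `prv i` and `nxt i` of cycle `j` are `A`-neighbours of `Γ j i`
      have hA : ∀ j' k, ((Γ.ringsInstance X).A (Γ.toFun j' k) (Γ.toFun j i) = true) ↔
          (j' = j ∧ (k = prv i ∨ k = nxt i)) := by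
        intro j' k
        rw [ringsInstance_A_apply]
        constructor
        · rintro ⟨rfl, h | h⟩
          · exact ⟨rfl, Or.inl (by rw [h, prv_nxt])⟩
          · exact ⟨rfl, Or.inr h⟩
        · rintro ⟨rfl, h | h⟩
          · exact ⟨rfl, Or.inl (by rw [h, nxt_prv])⟩
          · exact ⟨rfl, Or.inr h⟩
      rw [← Finset.sum_erase_add _ _ (mem_univ j)]
      rw [Finset.sum_eq_zero, zero_add]
      · rw [← Finset.sum_erase_add _ _ (mem_univ (prv i)),
          ← Finset.sum_erase_add _ _ (Finset.mem_erase.2 ⟨(prv_ne_nxt hn i).symm, mem_univ (nxt i)⟩)]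
        rw [Finset.sum_eq_zero]
        · simp only [hA, true_and, true_or, or_true, zero_add]
          rw [add_comm]
        · intro k hk
          rw [Finset.mem_erase, Finset.mem_erase] at hk
          rw [if_neg]
          rintro ⟨h, -⟩
          rcases ((hA j k).1 h).2 with h' | h'
          · exact hk.2.1 h'
          · exact hk.1 h'
      · intro j' hj'
        rw [Finset.mem_erase] at hj'
        apply Finset.sum_eq_zero
        intro k _
        rw [if_neg]
        rintro ⟨h, -⟩
        exact hj'.1 ((hA j' k).1 h).1
    · intro a ha
      rw [if_neg]
      rintro ⟨h, -⟩
      obtain ⟨j', ⟨k, hk⟩, -⟩ := ringsInstance_A_eq_true h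
      exact ha j' k hk
  · simp only [ringsInstance_b_apply]

/-- Off the cycles the kernel count vanishes (`A` and `b` are supported on the cycles). -/
theorem kerCount_eq_zero (X : Fin J → Fin n → Bool) (z : Fin N × Fin N → Bool) (a : Fin N × Fin N)
    (ha : ∀ j i, Γ.toFun j i ≠ a) : (Γ.ringsInstance X).kerCount z a = 0 := by
  unfold HLFInstance.kerCount
  rw [Finset.card_eq_zero.mpr, if_neg, add_zero]
  · rintro ⟨h, -⟩
    obtain ⟨j, i, hi⟩ := ringsInstance_b_eq_true h
    exact ha _ _ hi
  · rw [Finset.filter_eq_empty_iff]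
    rintro u - ⟨h, -⟩
    obtain ⟨j, -, ⟨k, hk⟩⟩ := ringsInstance_A_eq_true h
    exact ha j k hk

/-- Parity of a sum of three indicator bits as an `xor`. -/
private theorem even_ite_add_iff (a b c : Bool) :
    Even ((if a = true then 1 else 0) + (if b = true then 1 else 0) + (if c = true then 1 else 0) : ℕ) ↔
      (xor (xor a b) c) = false := by
  cases a <;> cases b <;> cases c <;> decide

/-- **`L_q` of a many-ring instance is the product of the ring kernels** (`n ≥ 3`): a grid vector `z` lies in
`L_q(ringsInstance Γ X)` iff for every cycle `j` its restriction to cycle `j` lies in `K(X j)`. -/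
theorem mem_Lq_iff (hn : 3 ≤ n) (X : Fin J → Fin n → Bool) (z : Fin N × Fin N → Bool) :
    z ∈ (Γ.ringsInstance X).Lq ↔ ∀ j, InKernel (X j) (fun i => z (Γ.toFun j i)) := by
  rw [HLFInstance.mem_Lq_iff _ (ringsInstance_isValid X)]
  constructor
  · intro h j b
    have hb := h (Γ.toFun j b)
    rw [kerCount_toFun hn] at hb
    rw [← even_ite_add_iff]
    convert hb using 3
    by_cases hx : X j b = true <;> by_cases hz : z (Γ.toFun j b) = true <;> simp [hx, hz]
  · intro h a
    by_cases ha : ∃ j i, Γ.toFun j i = a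
    · obtain ⟨j, i, rfl⟩ := ha
      rw [kerCount_toFun hn]
      have hb := h j i
      rw [← even_ite_add_iff] at hb
      convert hb using 3
      by_cases hx : X j i = true <;> by_cases hz : z (Γ.toFun j i) = true <;> simp [hx, hz]
    · rw [kerCount_eq_zero X z a (fun j i hi => ha ⟨j, i, hi⟩)]
      exact Even.zero

/-- From the `ℤ₄` identity `2e + w = 2c` to the bit identity `c ≡ e + w/2 (mod 2)`. -/
private theorem mod_two_of_zmod4 {e w c : ℕ} (h : (2 * e + w : ZMod 4) = 2 * c) :
    c % 2 = (e + w / 2) % 2 := by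
  have h4 : (2 * e + w) % 4 = (2 * c) % 4 := by
    have := (ZMod.natCast_eq_natCast_iff' (2 * e + w) (2 * c) 4).1 (by push_cast; exact h)
    exact this
  omega

/-- **HLF solutions of a many-ring instance solve every ring's relation** (`n ≥ 3`): if `z` is a 2D-HLF solution of
`ringsInstance Γ X`, then for every cycle `j` its restriction to cycle `j` satisfies `RingHLF.Rel (X j) (z ∘ Γ j)`
(evaluate the solution identity at the lift `1_v` of a kernel vector `v ∈ K(X j)` supported on cycle `j` alone). -/
theorem rel_of_mem_hlfSolutions (hn : 3 ≤ n) (X : Fin J → Fin n → Bool) {z : Fin N × Fin N → Bool}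
    (hz : z ∈ hlfSolutions (Γ.ringsInstance X)) (j : Fin J) : Rel (X j) (fun i => z (Γ.toFun j i)) := by
  intro v hv
  -- the lift `1_v` of `v` on cycle `j` lies in the kernel
  have hx : ∀ a, Even ((Γ.ringsInstance X).kerCount (Γ.ind j v) a) := by
    rw [← HLFInstance.mem_Lq_iff _ (ringsInstance_isValid X), mem_Lq_iff hn]
    intro j'
    by_cases hj : j' = j
    · subst hj; simpa only [ind_apply] using hv
    · simpa only [ind_apply_ne hj] using inKernel_zero (X j')
  have key := HLFInstance.solution_identity (Γ.ringsInstance X) (ringsInstance_isValid X) hz hx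
  -- evaluate the three counts on cycle `j`
  have hoff : ∀ a, (∀ i, Γ.toFun j i ≠ a) → Γ.ind j v a = false := by
    intro a ha
    rw [Bool.eq_false_iff]
    intro h
    obtain ⟨i, hi⟩ := ind_eq_true h
    exact ha i hi
  have hquad : (∑ a, ∑ a', if (Γ.ringsInstance X).A a a' = true ∧ Γ.ind j v a = true ∧
      Γ.ind j v a' = true then (1 : ZMod 4) else 0) = 2 * (edgesIn v : ZMod 4) := by
    rw [Γ.sum_eq_sum_cycle j]
    · have hin : ∀ i, (∑ a', if (Γ.ringsInstance X).A (Γ.toFun j i) a' = true ∧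
          Γ.ind j v (Γ.toFun j i) = true ∧ Γ.ind j v a' = true then (1 : ZMod 4) else 0) =
          (if v i = true ∧ v (nxt i) = true then (1 : ZMod 4) else 0) +
            (if v i = true ∧ v (prv i) = true then (1 : ZMod 4) else 0) := by
        intro i
        rw [Γ.sum_eq_sum_cycle j]
        · simp only [ringsInstance_A_apply, ind_apply, true_and]
          rw [← Finset.sum_erase_add _ _ (mem_univ (nxt i)),
            ← Finset.sum_erase_add _ _ (Finset.mem_erase.2 ⟨prv_ne_nxt hn i, mem_univ (prv i)⟩)]
          rw [Finset.sum_eq_zero, zero_add]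
          · have h2 : (prv i = nxt i ∨ i = nxt (prv i)) := Or.inr (by rw [nxt_prv])
            simp only [true_or, true_and, h2]
            rw [add_comm]
          · intro k hk
            rw [Finset.mem_erase, Finset.mem_erase] at hk
            rw [if_neg]
            rintro ⟨h, -⟩
            rcases h with h' | h'
            · exact hk.2.1 h'
            · exact hk.1 (by rw [h', prv_nxt])
        · intro a ha
          rw [if_neg]
          rintro ⟨-, -, h⟩
          exact absurd h (by rw [hoff a ha]; decide)
      simp_rw [hin]
      rw [Finset.sum_add_distrib, two_mul]
      congr 1
      · unfold edgesIn
        rw [natCast_card_filter]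
      · unfold edgesIn
        rw [natCast_card_filter]
        rw [show (∑ i : Fin n, if v i = true ∧ v (prv i) = true then (1 : ZMod 4) else 0) =
            ∑ i : Fin n, (if v (nxt (prv i)) = true ∧ v (prv i) = true then (1 : ZMod 4) else 0) by
          simp only [nxt_prv]]
        rw [show (∑ i : Fin n, if v (nxt (prv i)) = true ∧ v (prv i) = true then (1 : ZMod 4) else 0) =
            ∑ k : Fin n, (if v (nxt k) = true ∧ v k = true then (1 : ZMod 4) else 0) from
          Finset.sum_bij (fun i _ => prv i) (fun _ _ => mem_univ _)
            (fun a _ b _ h => prv_injective h) (fun k _ => ⟨nxt k, mem_univ _, prv_nxt k⟩)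
            (fun _ _ => rfl)]
        refine Finset.sum_congr rfl fun k _ => ?_
        simp only [and_comm]
    · intro a ha
      apply Finset.sum_eq_zero
      intro a' _
      rw [if_neg]
      rintro ⟨-, h, -⟩
      exact absurd h (by rw [hoff a ha]; decide)
  have hlin : (∑ a, if (Γ.ringsInstance X).b a = true ∧ Γ.ind j v a = true then (1 : ZMod 4) else 0) =
      (wtAnd (X j) v : ZMod 4) := by
    rw [Γ.sum_eq_sum_cycle j]
    · unfold wtAnd
      rw [natCast_card_filter]
      simp only [ringsInstance_b_apply, ind_apply]
    · intro a ha
      rw [if_neg]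
      rintro ⟨-, h⟩
      exact absurd h (by rw [hoff a ha]; decide)
  have hsol : ((univ.filter fun a => z a = true ∧ Γ.ind j v a = true).card : ZMod 4) =
      ((univ.filter fun b : Fin n => v b = true ∧ z (Γ.toFun j b) = true).card : ZMod 4) := by
    rw [natCast_card_filter, natCast_card_filter, Γ.sum_eq_sum_cycle j]
    · simp only [ind_apply, and_comm]
    · intro a ha
      rw [if_neg]
      rintro ⟨-, h⟩
      exact absurd h (by rw [hoff a ha]; decide)
  rw [hquad, hlin, hsol] at key
  -- conclude
  unfold dot2 signBit
  exact mod_two_of_zmod4 key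

/-- **The input string of a many-ring instance is a projection of the joint pattern.** Every coordinate of
`encodeHLF (ringsInstance Γ X)` is either a constant (the `A`-blocks; `b` off the cycles) or one pattern bit `X j i`. -/
theorem encodeHLF_ringsInstance_subst (Γ : GridCycles N J n) (c : Fin (inLen N)) :
    (∃ b, ∀ X : Fin J → Fin n → Bool, encodeHLF (Γ.ringsInstance X) c = b) ∨
      (∃ j i, ∀ X : Fin J → Fin n → Bool, encodeHLF (Γ.ringsInstance X) c = X j i) := by
  induction c using Fin.addCases with
  | left c =>
    left
    refine ⟨encodeHLF (Γ.ringsInstance fun _ _ => false) (Fin.castAdd (N * N) c), fun X => ?_⟩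
    induction c using Fin.addCases with
    | left k => simp only [encodeHLF_castAdd_castAdd, ringsInstance]
    | right k => simp only [encodeHLF_castAdd_natAdd, ringsInstance]
  | right k =>
    by_cases h : ∃ j i, Γ.toFun j i = finProdFinEquiv.symm k
    · obtain ⟨j, i, hi⟩ := h
      right
      refine ⟨j, i, fun X => ?_⟩
      rw [encodeHLF_natAdd, ← hi]
      rw [Bool.eq_iff_iff, ringsInstance_b_apply]
    · left
      refine ⟨false, fun X => ?_⟩
      rw [encodeHLF_natAdd, Bool.eq_false_iff]
      intro hb
      obtain ⟨j, i, hi⟩ := ringsInstance_b_eq_true hb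
      exact h ⟨j, i, hi⟩

end GridCycles

end Summit.QuantumAdvantage.QuantumAdvantage.Theorems
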